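import Summits.FinalStateConjecture.FinalStateConjecture.Theses.ZeroEnergyKerrOrBomb
import Literature.Geometry.Lorentzian.StationaryBlackHoleUniquenessProofs

/-!
# `NonTrappingHawkingRigidity` (crux `stmt-FinalStateConjecture-13896`): hypothesis h4 is redundant

Negative-lane load-bearing analysis for the crux `NonTrappingHawkingRigidity` of the routes
`ZeroEnergyKerrOrBomb` / `AnalyticityInvadesErgoregion` (cdisprove seat, cycle 1).  The crux
quantifies over stationary asymptotically flat black holes `𝓑 : StationaryAFBlackHole` with
hypotheses h1 vacuum, h2 `I⁺`-regular, h3 future-presented, h4 `∀ p ∈ 𝓑.doc, 𝓑.killing p ≠ 0`,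
h5 simply connected d.o.c., then a Killing–timelike collar `(U, K)` (h6–h14), belt compactness
mod `T` (h15) and non-trapping of zero-energy null geodesics mod `T` (h16).

**h4 follows from h2 for every presentation** (`killing_ne_zero_of_mem_doc_of_isIPlusRegular`):
`I⁺`-regularity makes `⟨⟨M_ext⟩⟩` a globally hyperbolic set, strong causality there forbids closed
timelike curves through its points, and Chruściel–Costa 2008, Cor. 3.8 — PROVED in the tree as
`StationaryAFBlackHole.IsIPlusRegular.killing_ne_zero_of_mem_doc`
(`Literature.Geometry.Lorentzian.StationaryBlackHoleUniquenessProofs`: a zero of the complete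
stationary Killing field in the d.o.c. is a compact flow-invariant set, which Lemma 3.7 turns into
a closed timelike curve) — gives `T ≠ 0` on the d.o.c.

Consequence (pure logic, `nonTrappingHawkingRigidity_iff_withoutH4`): the crux is equivalent to
the same statement with h4 deleted.  For provers: `T ≠ 0` on the d.o.c. is free (no Carleman or
unique-continuation input); for the planner: h4 is decoration and may be dropped at a restate.

References: P. T. Chruściel, J. L. Costa, *On uniqueness of stationary vacuum black holes*,
Astérisque 321 (2008), Def. 1.1, Lemma 3.7 and Cor. 3.8 (arXiv:0806.0016, §3).
-/

-- D-0017: single-problem summit, `Summit.<S>.<S>.…` by design (cf. lakefile `weak.linter.dupNamespace`).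
set_option linter.dupNamespace false

namespace Summit.FinalStateConjecture.FinalStateConjecture.Theorems.NonTrappingHawkingRigidity.Negative

open Literature.Geometry.Lorentzian
open scoped Manifold ContDiff
open Summit.FinalStateConjecture.FinalStateConjecture.Theses.ZeroEnergyKerrOrBomb
  (NonTrappingHawkingRigidity)

universe u

/-- **h2 ⇒ h4**: the stationary Killing field of an `I⁺`-regular black hole has no zero in the
domain of outer communications — hypothesis h4 of `NonTrappingHawkingRigidity` is implied by
hypothesis h2, for every presentation `𝓑` (Chruściel–Costa 2008, Cor. 3.8, tree theorem
`StationaryAFBlackHole.IsIPlusRegular.killing_ne_zero_of_mem_doc`). [cite: ChruscielCosta2008, Cor. 3.8] -/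
theorem killing_ne_zero_of_mem_doc_of_isIPlusRegular (𝓑 : StationaryAFBlackHole.{u})
    [𝓑.metric.HasLeviCivita] (h2 : 𝓑.IsIPlusRegular) :
    ∀ p ∈ 𝓑.doc, 𝓑.killing p ≠ 0 :=
  fun _ hp ↦ h2.killing_ne_zero_of_mem_doc hp

/-- **`NonTrappingHawkingRigidity` is equivalent to itself with h4 deleted** (the right-hand side is
the served statement of `stmt-FinalStateConjecture-13896` verbatim, minus the binder
`(∀ p ∈ 𝓑.doc, 𝓑.killing p ≠ 0) →`).  Pure logic over
`killing_ne_zero_of_mem_doc_of_isIPlusRegular`. [folklore] -/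
theorem nonTrappingHawkingRigidity_iff_withoutH4 :
    NonTrappingHawkingRigidity ↔
      ∀ (𝓑 : StationaryAFBlackHole.{0}) [𝓑.metric.HasLeviCivita],
        𝓑.metric.toPseudoRiemannianMetric.IsRicciFlat → 𝓑.IsIPlusRegular →
        (∀ p : 𝓑.carrier, p ∈ 𝓑.metric.chronologicalFuture 𝓑.timeOrientation 𝓑.Mext) →
        SimplyConnectedSpace 𝓑.doc →
        ∀ (U : Set 𝓑.carrier) (K : Π x : 𝓑.carrier, TangentSpace (𝓡 4) x), IsOpen U →
          𝓑.horizon ⊆ U → IsConnected 𝓑.horizon →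
          ContMDiffOn (𝓡 4) ((𝓡 4).prod 𝓘(ℝ, E4)) ((⊤ : ℕ∞) : WithTop ℕ∞)
            (fun x ↦ (Bundle.TotalSpace.mk' E4 x (K x) : TangentBundle (𝓡 4) 𝓑.carrier)) U →
          (∀ x ∈ U, ∀ v w : TangentSpace (𝓡 4) x,
            𝓑.metric.val x (𝓑.metric.leviCivita K x v) w +
              𝓑.metric.val x v (𝓑.metric.leviCivita K x w) = 0) →
          (∀ x ∈ U, VectorField.mlieBracket (𝓡 4) 𝓑.killing K x = 0) →
          (∀ p ∈ 𝓑.horizon, K p ≠ 0) →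
          (∀ γ : ℝ → 𝓑.carrier, IsMIntegralCurve γ K → γ 0 ∈ 𝓑.horizon → ∀ t, γ t ∈ 𝓑.horizon) →
          (∀ x ∈ U ∩ 𝓑.doc, 𝓑.metric.val x (K x) (K x) < 0) →
          (∃ S₀ : Set 𝓑.carrier, IsCompact S₀ ∧ S₀ ⊆ 𝓑.doc ∧ ∀ y ∈ 𝓑.doc,
            0 ≤ 𝓑.metric.val y (𝓑.killing y) (𝓑.killing y) → y ∉ U →
              y ∈ stationaryOrbit 𝓑.killing S₀) →
          (∀ S : Set 𝓑.carrier, IsCompact S → S ⊆ 𝓑.doc →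
            ∀ (γ : ℝ → 𝓑.carrier) (s : Set ℝ),
              IsMaximalGeodesicOn 𝓑.metric.toPseudoRiemannianMetric.leviCivita γ s →
              s.Nonempty →
              (∀ t ∈ s, 𝓑.metric.val (γ t) (velocity (𝓡 4) γ t) (velocity (𝓡 4) γ t) = 0 ∧
                velocity (𝓡 4) γ t ≠ 0 ∧
                𝓑.metric.val (γ t) (velocity (𝓡 4) γ t) (𝓑.killing (γ t)) = 0) →
              ∃ t ∈ s, γ t ∉ stationaryOrbit 𝓑.killing S) →
          ∃ K' : Π x : 𝓑.carrier, TangentSpace (𝓡 4) x,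
            ContMDiffOn (𝓡 4) ((𝓡 4).prod 𝓘(ℝ, E4)) ((⊤ : ℕ∞) : WithTop ℕ∞)
              (fun x ↦ (Bundle.TotalSpace.mk' E4 x (K' x) : TangentBundle (𝓡 4) 𝓑.carrier))
              𝓑.doc ∧
            (∀ x ∈ 𝓑.doc, ∀ v w : TangentSpace (𝓡 4) x,
              𝓑.metric.val x (𝓑.metric.leviCivita K' x v) w +
                𝓑.metric.val x v (𝓑.metric.leviCivita K' x w) = 0) ∧
            (∀ x ∈ 𝓑.doc, VectorField.mlieBracket (𝓡 4) 𝓑.killing K' x = 0) ∧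
            ∃ U' : Set 𝓑.carrier, IsOpen U' ∧ 𝓑.horizon ⊆ U' ∧ ∀ x ∈ U' ∩ 𝓑.doc, K' x = K x :=
  ⟨fun h 𝓑 _ h1 h2 h3 h5 U K ↦
      h 𝓑 h1 h2 h3 (killing_ne_zero_of_mem_doc_of_isIPlusRegular 𝓑 h2) h5 U K,
    fun h 𝓑 _ h1 h2 h3 _ h5 U K ↦ h 𝓑 h1 h2 h3 h5 U K⟩

end Summit.FinalStateConjecture.FinalStateConjecture.Theorems.NonTrappingHawkingRigidity.Negative
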